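import Summits.RiemannHypothesis.RiemannHypothesis.Theses.PluckedString
import Literature.NumberTheory.LFunctions.ZetaScrewHermitianFormsProofs
import Literature.Analysis.Matrix.PosDefKernelDoubleIntegral

/-!
# Route `PluckedString`, support item `ScrewToWeilOn` (stmt-RiemannHypothesis-2624) — CLOSED by name

**Statement (the route decl, verbatim).** For every `a : ℝ`: if the real quadratic forms of Suzuki's kernel
`G(t,u) = Ψ(t) + Ψ(u) − Ψ(t − u)` (`Ψ = zetaScrew`, `G = zetaScrewKernel`, Suzuki 2023 (1.4)) are non-negative on
every finite configuration `t₁, …, t_N ∈ [−a, a]`, then `WeilPositivityOn a` (Weil's quadratic functional is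
non-negative on smooth `g` supported in `[−a, a]`).

**Proof.** For `a ≤ 0` the window is degenerate and `WeilPositivityOn a` holds unconditionally
(`weilPositivityOn_of_le_log_two_half`). For `a > 0`: Suzuki 2023 Prop. 3.1 in the tree's normalisation
(`weilQuadratic_eq_zetaScrewForm_deriv`, RH-free) gives `Q(g) = ∫_{(−a,a)}∫_{(−a,a)} G(t,u) φ(u) conj φ(t) du dt`
with `φ = g′` continuous; writing `φ = φᵣ + iφᵢ`,
`Re Q(g) = ∫∫ φᵣ(t)φᵣ(u)G(t,u) + ∫∫ φᵢ(t)φᵢ(u)G(t,u)`, and each real double integral of the continuous,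
symmetric, finitely-PSD kernel `G` over the compact window is `≥ 0` by the tree's integrated-positivity
lemma `Literature.Analysis.Matrix.IsPosDefKernel.integral_integral_nonneg_of_isFiniteMeasure`
(Berg–Christensen–Ressel Ch. 4 §1; sampling proof: the Gram sum of `N` i.i.d. uniform points has
non-negative expectation `N·D + N(N−1)·I`), applied on the compact type `Icc (−a) a` with the measure
`comap Subtype.val volume` and transferred back by `integral_subtype_comap`. "Real-vector PSD suffices since
the kernel is real symmetric" is exactly this re/im split.

LABEL: RH-FREE glue (window dictionary rung ↔ depth: kernel positivity on `|t| ≤ a` ⟹ Weil positivity on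
`[−a, a]`). WHAT THIS IS NOT: no positivity of the kernel is asserted; nothing here bears on the truth of RH.

References: M. Suzuki, J. Lond. Math. Soc. (2) 108 (2023) = arXiv:2206.03682, (1.4), Prop. 3.1;
C. Berg, J. P. R. Christensen, P. Ressel, *Harmonic Analysis on Semigroups* (1984), Ch. 3 Def. 1.1, Ch. 4 §1.
-/

-- `Summit.RiemannHypothesis.RiemannHypothesis.…` duplicates `RiemannHypothesis` BY DESIGN (D-0017).
set_option linter.dupNamespace false

noncomputable section

open MeasureTheory Set Complex
open scoped ComplexConjugate

namespace Summit.RiemannHypothesis.RiemannHypothesis.Theorems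

open Literature.NumberTheory.LFunctions Literature.Analysis.Matrix

namespace ScrewToWeilOn

/-- Suzuki's kernel `G(t,u) = Ψ(t) + Ψ(u) − Ψ(t−u)` composed with two continuous maps is continuous
(from `continuous_zetaScrew`); in particular `G` is jointly continuous. [folklore] -/
theorem continuous_zetaScrewKernel_comp {Y : Type*} [TopologicalSpace Y] {f g : Y → ℝ}
    (hf : Continuous f) (hg : Continuous g) : Continuous fun y => zetaScrewKernel (f y) (g y) := by
  unfold zetaScrewKernel
  exact ((continuous_zetaScrew.comp hf).add (continuous_zetaScrew.comp hg)).sub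
    (continuous_zetaScrew.comp (hf.sub hg))

/-- Lebesgue measure pulled back to the window type `Icc (−a) a` is finite (its total mass is
`volume (Icc (−a) a) < ∞`). [folklore] -/
theorem isFiniteMeasure_comap_val_Icc (a : ℝ) :
    IsFiniteMeasure (Measure.comap Subtype.val volume : Measure (Icc (-a) a)) := by
  refine ⟨?_⟩
  rw [comap_subtype_coe_apply measurableSet_Icc, image_univ, Subtype.range_coe]
  exact measure_Icc_lt_top

/-- **Integrated positivity on the window.** If the real quadratic forms of `G = zetaScrewKernel` are
non-negative on every finite configuration in `[−a, a]`, then for every continuous real weight `ψ`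
the double integral `∫_{[−a,a]} ∫_{[−a,a]} ψ(t) ψ(u) G(t,u) du dt` is non-negative — the tree's sampling
lemma `IsPosDefKernel.integral_integral_nonneg_of_isFiniteMeasure` on the compact type `Icc (−a) a` with
the measure `comap Subtype.val volume`, transferred by `integral_subtype_comap`. [folklore] -/
theorem setIntegral_setIntegral_mul_mul_zetaScrewKernel_nonneg {a : ℝ}
    (hpsd : ∀ (N : ℕ) (t x : Fin N → ℝ), (∀ i, |t i| ≤ a) →
      0 ≤ ∑ i, ∑ j, zetaScrewKernel (t i) (t j) * (x i * x j))
    {ψ : ℝ → ℝ} (hψ : Continuous ψ) :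
    0 ≤ ∫ t in Icc (-a) a, ∫ u in Icc (-a) a, ψ t * ψ u * zetaScrewKernel t u := by
  haveI := isFiniteMeasure_comap_val_Icc a
  -- the kernel restricted to the window is a positive definite kernel in the sense of BCR Def. 3.1.1
  have hK : IsPosDefKernel (fun x y : Icc (-a) a => zetaScrewKernel x.1 y.1) := by
    refine ⟨fun x y => zetaScrewKernel_comm _ _, fun n x c => ?_⟩
    have h := hpsd n (fun j => (x j).1) c (fun j => abs_le.2 ⟨(x j).2.1, (x j).2.2⟩)
    refine h.trans_eq (Finset.sum_congr rfl fun j _ => Finset.sum_congr rfl fun k _ => ?_)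
    ring
  have hKc : Continuous fun p : Icc (-a) a × Icc (-a) a => zetaScrewKernel p.1.1 p.2.1 :=
    continuous_zetaScrewKernel_comp (continuous_subtype_val.comp continuous_fst)
      (continuous_subtype_val.comp continuous_snd)
  have hφ : Continuous fun x : Icc (-a) a => ψ x.1 := hψ.comp continuous_subtype_val
  have h := hK.integral_integral_nonneg_of_isFiniteMeasure hKc
    (Measure.comap Subtype.val volume : Measure (Icc (-a) a)) hφ
  -- back to set integrals over `Icc (-a) a`
  have hin : ∀ x : Icc (-a) a,
      ∫ y : Icc (-a) a, ψ x.1 * ψ y.1 * zetaScrewKernel x.1 y.1 ∂(Measure.comap Subtype.val volume) =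
        ∫ u in Icc (-a) a, ψ x.1 * ψ u * zetaScrewKernel x.1 u := fun x =>
    integral_subtype_comap measurableSet_Icc (fun u => ψ x.1 * ψ u * zetaScrewKernel x.1 u)
  simp_rw [hin] at h
  rwa [integral_subtype_comap measurableSet_Icc
    (fun t => ∫ u in Icc (-a) a, ψ t * ψ u * zetaScrewKernel t u)] at h

/-- **Real part of Suzuki's hermitian form on the compact window.** For continuous `φ : ℝ → ℂ`,
`Re ∫_{[−a,a]}∫_{[−a,a]} G(t,u) φ(u) conj φ(t) du dt = ∫∫ φᵣ(t)φᵣ(u)G(t,u) + ∫∫ φᵢ(t)φᵢ(u)G(t,u)`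
(`φ = φᵣ + iφᵢ`; all integrands are continuous on the compact square, so `re` and `+` commute with the
Bochner integrals). [folklore] -/
theorem re_setIntegral_setIntegral_zetaScrewKernel (a : ℝ) {φ : ℝ → ℂ} (hφc : Continuous φ) :
    (∫ t in Icc (-a) a, ∫ u in Icc (-a) a, (zetaScrewKernel t u : ℂ) * φ u * conj (φ t)).re =
      (∫ t in Icc (-a) a, ∫ u in Icc (-a) a, (φ t).re * (φ u).re * zetaScrewKernel t u) +
        ∫ t in Icc (-a) a, ∫ u in Icc (-a) a, (φ t).im * (φ u).im * zetaScrewKernel t u := by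
  have hKc : Continuous fun p : ℝ × ℝ => zetaScrewKernel p.1 p.2 :=
    continuous_zetaScrewKernel_comp continuous_fst continuous_snd
  have hφrc : Continuous fun u => (φ u).re := continuous_re.comp hφc
  have hφic : Continuous fun u => (φ u).im := continuous_im.comp hφc
  -- the three jointly continuous integrands
  have hfc : Continuous (Function.uncurry fun t u : ℝ => (zetaScrewKernel t u : ℂ) * φ u * conj (φ t)) :=
    ((continuous_ofReal.comp hKc).mul (hφc.comp continuous_snd)).mul
      ((continuous_conj.comp hφc).comp continuous_fst)
  have hAc : Continuous (Function.uncurry fun t u : ℝ => (φ t).re * (φ u).re * zetaScrewKernel t u) :=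
    ((hφrc.comp continuous_fst).mul (hφrc.comp continuous_snd)).mul hKc
  have hBc : Continuous (Function.uncurry fun t u : ℝ => (φ t).im * (φ u).im * zetaScrewKernel t u) :=
    ((hφic.comp continuous_fst).mul (hφic.comp continuous_snd)).mul hKc
  -- pointwise real part
  have hf_re : ∀ t u : ℝ, ((zetaScrewKernel t u : ℂ) * φ u * conj (φ t)).re =
      (φ t).re * (φ u).re * zetaScrewKernel t u + (φ t).im * (φ u).im * zetaScrewKernel t u := by
    intro t u
    simp only [Complex.mul_re, Complex.mul_im, Complex.ofReal_re, Complex.ofReal_im,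
      Complex.conj_re, Complex.conj_im]
    ring
  -- real part of the inner integrals
  have hre_in : ∀ t, (∫ u in Icc (-a) a, (zetaScrewKernel t u : ℂ) * φ u * conj (φ t)).re =
      (∫ u in Icc (-a) a, (φ t).re * (φ u).re * zetaScrewKernel t u) +
        ∫ u in Icc (-a) a, (φ t).im * (φ u).im * zetaScrewKernel t u := by
    intro t
    have h1 := integral_re ((hfc.uncurry_left t).integrableOn_Icc (a := -a) (b := a) (μ := volume))
    simp only [RCLike.re_to_complex] at h1
    rw [← h1]
    simp_rw [hf_re]
    exact integral_add ((hAc.uncurry_left t).integrableOn_Icc) ((hBc.uncurry_left t).integrableOn_Icc)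
  -- real part of the outer integral
  have hFi : IntegrableOn (fun t => ∫ u in Icc (-a) a, (zetaScrewKernel t u : ℂ) * φ u * conj (φ t))
      (Icc (-a) a) :=
    (continuous_parametric_integral_of_continuous hfc isCompact_Icc).integrableOn_Icc
  have h2 := integral_re hFi
  simp only [RCLike.re_to_complex] at h2
  rw [← h2]
  simp_rw [hre_in]
  exact integral_add
    (continuous_parametric_integral_of_continuous hAc isCompact_Icc).integrableOn_Icc
    (continuous_parametric_integral_of_continuous hBc isCompact_Icc).integrableOn_Icc

end ScrewToWeilOn

open ScrewToWeilOn in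
/-- **`ScrewToWeilOn`** (route `PluckedString`, item stmt-RiemannHypothesis-2624): for every `a`, if
`∑ᵢⱼ (Ψ(tᵢ) + Ψ(tⱼ) − Ψ(tᵢ − tⱼ)) xᵢ xⱼ ≥ 0` for all finite real configurations with `|tᵢ| ≤ a`, then
`WeilPositivityOn a`. Degenerate windows `a ≤ 0` hold unconditionally; for `a > 0`, Suzuki 2023 Prop. 3.1
(`weilQuadratic_eq_zetaScrewForm_deriv`) + the re/im split of `g′` + integrated positivity of the continuous
finitely-PSD kernel on the compact window (`setIntegral_setIntegral_mul_mul_zetaScrewKernel_nonneg`).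
[cite: Suzuki2023, Prop 3.1 and (1.4)] -/
theorem screwToWeilOn_proof :
    Summit.RiemannHypothesis.RiemannHypothesis.Theses.PluckedString.ScrewToWeilOn := by
  intro a hpsd
  -- the route's inline `Ψ` is `zetaScrew` and the inline kernel is `zetaScrewKernel`, definitionally
  have hpsd' : ∀ (N : ℕ) (t x : Fin N → ℝ), (∀ i, |t i| ≤ a) →
      0 ≤ ∑ i, ∑ j, zetaScrewKernel (t i) (t j) * (x i * x j) := hpsd
  by_cases ha : 0 < a
  swap
  · exact weilPositivityOn_of_le_log_two_half
      ((not_lt.1 ha).trans (div_nonneg (Real.log_nonneg one_le_two) zero_le_two))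
  intro g hg hsupp
  have hψ : g ∈ screwTestC a := ⟨hg, hsupp⟩
  have hφc : Continuous (deriv g) := hg.1.continuous_deriv (by simp)
  rw [weilQuadratic_eq_zetaScrewForm_deriv ha hψ]
  -- the window `Ioo` may be replaced by the compact `Icc` (null endpoints)
  have hS : zetaScrewForm (Ioo (-a) a) (deriv g) (deriv g) =
      ∫ t in Icc (-a) a, ∫ u in Icc (-a) a,
        (zetaScrewKernel t u : ℂ) * deriv g u * conj (deriv g t) := by
    unfold zetaScrewForm
    rw [setIntegral_congr_set Ioo_ae_eq_Icc]
    refine setIntegral_congr_fun measurableSet_Icc fun t _ => ?_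
    exact setIntegral_congr_set Ioo_ae_eq_Icc
  rw [hS, re_setIntegral_setIntegral_zetaScrewKernel a hφc]
  exact add_nonneg
    (setIntegral_setIntegral_mul_mul_zetaScrewKernel_nonneg hpsd' (continuous_re.comp hφc))
    (setIntegral_setIntegral_mul_mul_zetaScrewKernel_nonneg hpsd' (continuous_im.comp hφc))

end Summit.RiemannHypothesis.RiemannHypothesis.Theorems

end
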